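import Mathlib
import HarnessLib
import Summits.NavierStokesRegularity.NavierStokesRegularity.Theorems.PoloidalWindowDoorLrcModEntireShearedSecondOrder
import Summits.NavierStokesRegularity.NavierStokesRegularity.Theorems.PoloidalWindowDoorLrcModEntireHorizDerivTransportLaw
import Summits.NavierStokesRegularity.NavierStokesRegularity.Theorems.PoloidalWindowDoorLrcModEntireHorizDerivLaplacianSplit
import Summits.NavierStokesRegularity.NavierStokesRegularity.Theorems.PoloidalWindowDoorPoloidalWindowRigidityConstantShearSlice

/-!
# Route `PoloidalWindowDoor`, item `LrcModEntire` (stmt-NavierStokesRegularity-20428), cell (Q4-sonic), slot `stub_Q4sonicLineNeg`, case I —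
# S4c WIRING, STEPS (ii)+(iii): THE SECOND-ORDER ROW OF THE MIXED SYSTEM IN SHEARED COORDINATES (class level)

Cell ns-regularity-ideate, helper seat ns-k2-port-2 g8 under the LEAD of item 20428 (ns-poloidal-K2-p3 g17, memo `T2B-g17.md` v4 §7 S4; custody
`RECORD-OF-CUSTODY-port-2-g8.md` §8 recipe (ii)–(iii)); `--supports stmt-NavierStokesRegularity-20428 --as helper`.

Class profile `U` (Type-I ancient mild, poloidal), (TH) slab law `∂_zU_b = μ(t,z)∂_bU₂` for `|t+1| < ρ`, `|x₂| < ρ` with `μ ∈ C³` jointly, a horizontal unit vector `e`,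
the moving shear `Φ` of `…ShearedCoordinates` over a parameter set `O` whose points `(t,s,z)` have `t < 0`, `|t+1| < ρ`, `|z| < ρ`, `(t,z) ∈ D` (`d ∈ C^∞(D)`), and
the pulled-back unknowns `g = gST W e ∘ Φ`, `P = PST W e ∘ Φ`, `Q = QST W e ∘ Φ` with `W = uncurry U` (`…ShearedKinematics`).
* ★★ `verticalRow_sheared` — at every tube point `p`, with `(t,x) = Φp`, `z = x₂`, `μ = μ(t,z)`, `d_t, d_z` the derivatives of `d` at `(t,z)`,
  `U_e = U·e`, `U_ν = U·Je`, `θ = U₂`, `θ_ν = ∂_{Je}U₂`, `θ_z = ∂_zU₂` at `(t,x)`: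
  **`(1−μ)·[ (∂_t′ − d_t∂_m)g + U_e∂_sg + U_ν∂_mg + θ(∂_z′ − d_z∂_m)g − (1−μ)(∂_m²g + ∂_s²g) + P·g + Q·θ_ν + g·θ_z ] = (μ_t + θμ_z − μ_zz)·g − 2μ_z·(∂_z′ − d_z∂_m)g`**
  — `…HorizDerivTransportLaw.horizDeriv_two_transport_law` with every term pulled back (`…ShearedCoordinates`, `…ShearedSecondOrder`,
  `…HorizDerivLaplacianSplit.laplacian_horizDeriv_two`, `coupling_frame`).  Solving for `∂_m²g` (`1 − μ ≠ 0`) gives the `hstep` row for `g` of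
  `…SheetSystemUniqueness.vanishesToOrder_all_of_mixedSystem`.
WHAT THIS IS NOT: not a claim about Navier–Stokes regularity; no stub is closed here; items 20428 / 19708 / 27893 OPEN.
-/

noncomputable section

set_option linter.dupNamespace false
set_option linter.style.longLine false

namespace Summit.NavierStokesRegularity.NavierStokesRegularity.Theorems.PoloidalWindowDoorLrcModEntireShearedVerticalRow

open Set Function Filter Topology Metric
open scoped RealInnerProductSpace InnerProductSpace Laplacian ContDiff
open Literature.Analysis
open Summit.NavierStokesRegularity.NavierStokesRegularity.Theorems.LocalSineTubeDoorProfileAlignedWindowRigidityAncient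
open Summit.NavierStokesRegularity.NavierStokesRegularity.Theorems.PoloidalWindowDoorPoloidalWindowRigidityWindow
open Summit.NavierStokesRegularity.NavierStokesRegularity.Theorems.PoloidalWindowDoorPoloidalWindowRigidityConstantShearSlice
open Summit.NavierStokesRegularity.NavierStokesRegularity.Theorems.PoloidalWindowDoorLrcModEntireSheetSystemUniqueness
open Summit.NavierStokesRegularity.NavierStokesRegularity.Theorems.PoloidalWindowDoorLrcModEntireSheetFlattenTools
open Summit.NavierStokesRegularity.NavierStokesRegularity.Theorems.PoloidalWindowDoorLrcModEntireShearedCoordinates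
open Summit.NavierStokesRegularity.NavierStokesRegularity.Theorems.PoloidalWindowDoorLrcModEntireShearedKinematics
open Summit.NavierStokesRegularity.NavierStokesRegularity.Theorems.PoloidalWindowDoorLrcModEntireShearedSecondOrder
open Summit.NavierStokesRegularity.NavierStokesRegularity.Theorems.PoloidalWindowDoorLrcModEntireHorizDerivTransportLaw
open Summit.NavierStokesRegularity.NavierStokesRegularity.Theorems.PoloidalWindowDoorLrcModEntireHorizDerivLaplacianSplit
open Summit.NavierStokesRegularity.NavierStokesRegularity.Theorems.PoloidalWindowDoorLrcModEntireQ4SonicHotSheetJet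

variable {C : ℝ} {U : ℝ → E3 → E3} {μ : ℝ → ℝ → ℝ} {ρ : ℝ} {e : E3} {O : Set Y3} {D : Set (ℝ × ℝ)} {d : ℝ × ℝ → ℝ}

/-- ★★ **THE SECOND-ORDER ROW OF THE MIXED SYSTEM IN SHEARED COORDINATES.**  See the module docstring (`W = uncurry U`). -/
theorem verticalRow_sheared
    (hrate : FluidPDE.HasTypeITimeDecay C U) (hcont : ContinuousOn (uncurry U) (Iio (0 : ℝ) ×ˢ univ))
    (hmild : ∀ s t : ℝ, s < t → t < 0 → ∀ x, U t x = UnboundedOperators.heatExtension (U s) (t - s) x - FluidPDE.oseenDuhamel 1 s U U t x)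
    (hdiv : ∀ t < 0, FluidPDE.VectorCalculus.IsDivFree (U t))
    (hpol : ∀ s < 0, ∀ y, ⟪FluidPDE.curl (U s) y, EuclideanSpace.single 2 1⟫_ℝ = 0)
    (hμ3 : ContDiff ℝ 3 (uncurry μ))
    (hslabU : ∀ t : ℝ, |t + 1| < ρ → ∀ x : E3, |x 2| < ρ → ∀ b : Fin 3, b ≠ 2 →
      fderiv ℝ (U t) x (EuclideanSpace.single 2 1) b = μ t (x 2) * fderiv ℝ (U t) x (EuclideanSpace.single b 1) 2)
    (he2 : e 2 = 0) (hunit : e 0 ^ 2 + e 1 ^ 2 = 1)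
    (hO : IsOpen O) (hOt : ∀ y ∈ O, y.1 < 0 ∧ |y.1 + 1| < ρ ∧ |y.2.2| < ρ)
    (hD : IsOpen D) (hd : ContDiffOn ℝ ∞ d D) (hOD : ∀ y ∈ O, (y.1, y.2.2) ∈ D) {p : Y3 × ℝ} (hp : p ∈ tube O) :
    (1 - μ p.1.1 p.1.2.2) *
        ((pd (tg eT) (gST (uncurry U) e ∘ shearMap e d) p
            - fderiv ℝ d (p.1.1, p.1.2.2) ((1 : ℝ), (0 : ℝ)) * pd dN (gST (uncurry U) e ∘ shearMap e d) p)
          + ((U p.1.1 (shearPt e d p) 0 * e 0 + U p.1.1 (shearPt e d p) 1 * e 1) * pd (tg eS) (gST (uncurry U) e ∘ shearMap e d) p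
              + (U p.1.1 (shearPt e d p) 1 * e 0 - U p.1.1 (shearPt e d p) 0 * e 1) * pd dN (gST (uncurry U) e ∘ shearMap e d) p
              + U p.1.1 (shearPt e d p) 2 * (pd (tg PoloidalWindowDoorLrcModEntireShearedCoordinates.eZ) (gST (uncurry U) e ∘ shearMap e d) p
                  - fderiv ℝ d (p.1.1, p.1.2.2) ((0 : ℝ), (1 : ℝ)) * pd dN (gST (uncurry U) e ∘ shearMap e d) p))
          - (1 - μ p.1.1 p.1.2.2) * (pd dN (pd dN (gST (uncurry U) e ∘ shearMap e d)) p + pd (tg eS) (pd (tg eS) (gST (uncurry U) e ∘ shearMap e d)) p)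
          + ((PST (uncurry U) e ∘ shearMap e d) p * (gST (uncurry U) e ∘ shearMap e d) p
              + (QST (uncurry U) e ∘ shearMap e d) p * fderiv ℝ (U p.1.1) (shearPt e d p) (Jvec e) 2
              + (gST (uncurry U) e ∘ shearMap e d) p * fderiv ℝ (U p.1.1) (shearPt e d p) e2 2)) =
      (deriv (fun s => μ s p.1.2.2) p.1.1 + U p.1.1 (shearPt e d p) 2 * deriv (μ p.1.1) p.1.2.2 - deriv (deriv (μ p.1.1)) p.1.2.2) *
          (gST (uncurry U) e ∘ shearMap e d) p
        - 2 * deriv (μ p.1.1) p.1.2.2 * (pd (tg PoloidalWindowDoorLrcModEntireShearedCoordinates.eZ) (gST (uncurry U) e ∘ shearMap e d) p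
            - fderiv ℝ d (p.1.1, p.1.2.2) ((0 : ℝ), (1 : ℝ)) * pd dN (gST (uncurry U) e ∘ shearMap e d) p) := by
  set W : ℝ × E3 → E3 := uncurry U with hW_def
  set g : Y3 × ℝ → ℝ := gST W e ∘ shearMap e d with hg_def
  set t : ℝ := p.1.1 with ht_def
  set x : E3 := shearPt e d p with hx_def
  set z : ℝ := p.1.2.2 with hz_def
  obtain ⟨ht0, htρ, hzρ⟩ := hOt p.1 hp
  have hdp : DifferentiableAt ℝ d (t, z) := (hd.contDiffAt (hD.mem_nhds (hOD p.1 hp))).differentiableAt (by simp)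
  -- the slice, the point, the height
  have hx2 : x 2 = z := by
    rw [hx_def, hz_def]; simp [shearPt, Jvec, e2, he2]
  have hWt : (fun y : E3 => W (t, y)) = U t := rfl
  -- joint smoothness of `W` on `Iio 0 × ℝ³` and the tube hypotheses
  set T : Set ℝ := Iio 0 with hT_def
  have hT : IsOpen T := isOpen_Iio
  have hA := isTypeIAncientMild_of_class hrate hcont hmild hdiv
  have hW : ContDiffOn ℝ ∞ W (T ×ˢ (univ : Set E3)) := hA.contDiffOn
  have hOT : ∀ y ∈ O, y.1 ∈ T := fun y hy => (hOt y hy).1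
  have htT : t ∈ T := ht0
  have hs : ContDiff ℝ ∞ (U t) := hA.contDiff_slice ht0
  obtain ⟨hgs, hPs, hQs⟩ := contDiffOn_gST_PST_QST (e := e) hT hW
  obtain ⟨-, hGd, -⟩ := gST_regular (e := e) hT hW (q := (t, x)) htT
  /- (1) the class-level transport law at `(t, x)` -/
  have hslope : ∀ᶠ q in 𝓝 ((t, x) : ℝ × E3), ∀ b : Fin 3, b ≠ 2 →
      fderiv ℝ (U q.1) q.2 (EuclideanSpace.single 2 1) b = μ q.1 (q.2 2) * fderiv ℝ (U q.1) q.2 (EuclideanSpace.single b 1) 2 := by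
    have hOpen : IsOpen {q : ℝ × E3 | |q.1 + 1| < ρ ∧ |q.2 2| < ρ} := by
      refine IsOpen.and ?_ ?_
      · exact isOpen_lt (continuous_abs.comp (continuous_fst.add continuous_const)) continuous_const
      · exact isOpen_lt (continuous_abs.comp ((EuclideanSpace.proj (𝕜 := ℝ) (2 : Fin 3)).continuous.comp continuous_snd)) continuous_const
    have hmem : ((t, x) : ℝ × E3) ∈ {q : ℝ × E3 | |q.1 + 1| < ρ ∧ |q.2 2| < ρ} := ⟨htρ, by show |x 2| < ρ; rw [hx2]; exact hzρ⟩
    filter_upwards [hOpen.mem_nhds hmem] with q hq' b hb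
    exact hslabU q.1 hq'.1 q.2 hq'.2 b hb
  have hμx : ContDiff ℝ 2 (μ t) := (hμ3.comp (contDiff_const.prodMk contDiff_id)).of_le (by norm_num)
  have hμline : DifferentiableAt ℝ (fun s => μ s (x 2)) t :=
    ((hμ3.differentiable (by norm_num)) _).comp t (differentiableAt_id.prodMk (differentiableAt_const _))
  have hlaw := horizDeriv_two_transport_law hrate hcont hmild hdiv hpol ht0 x hslope hμx hμline.hasDerivAt he2
  rw [hx2] at hlaw
  /- (2) pull back each term by the chain rules of the moving shear -/
  have hm' : pd dN g p = fderiv ℝ (gST W e) (t, x) ((0 : ℝ), Jvec e) := pd_dN_comp_shearMap e d (F := gST W e) (p := p) hGd hdp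
  have hs' : pd (tg eS) g p = fderiv ℝ (gST W e) (t, x) ((0 : ℝ), e) := pd_tgS_comp_shearMap e d (F := gST W e) (p := p) hGd hdp
  have hz' : pd (tg PoloidalWindowDoorLrcModEntireShearedCoordinates.eZ) g p - fderiv ℝ d (t, z) ((0 : ℝ), (1 : ℝ)) * pd dN g p = fderiv ℝ (gST W e) (t, x) ((0 : ℝ), e2) :=
    pd_tgZ_sub_comp_shearMap e d (F := gST W e) (p := p) hGd hdp
  have ht' : pd (tg eT) g p - fderiv ℝ d (t, z) ((1 : ℝ), (0 : ℝ)) * pd dN g p = fderiv ℝ (gST W e) (t, x) ((1 : ℝ), (0 : E3)) :=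
    pd_tgT_sub_comp_shearMap e d (F := gST W e) (p := p) hGd hdp
  have hsp : ∀ w : E3, fderiv ℝ (gST W e) (t, x) ((0 : ℝ), w) = fderiv ℝ (fun y : E3 => fderiv ℝ (U t) y e 2) x w :=
    fun w => fderiv_gST_space (e := e) hT hW htT x w
  -- (a) the time derivative
  have h_a : deriv (fun s => fderiv ℝ (U s) x e 2) t = pd (tg eT) g p - fderiv ℝ d (t, z) ((1 : ℝ), (0 : ℝ)) * pd dN g p := by
    rw [ht']; exact (fderiv_gST_time (e := e) hT hW htT x).symm
  -- (b) the convective derivative, `U = U_e·e + U_ν·Je + θ·e₂`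
  have h_b : fderiv ℝ (fun y : E3 => fderiv ℝ (U t) y e 2) x (U t x) =
      (U t x 0 * e 0 + U t x 1 * e 1) * pd (tg eS) g p + (U t x 1 * e 0 - U t x 0 * e 1) * pd dN g p
        + U t x 2 * (pd (tg PoloidalWindowDoorLrcModEntireShearedCoordinates.eZ) g p - fderiv ℝ d (t, z) ((0 : ℝ), (1 : ℝ)) * pd dN g p) := by
    rw [hz', hs', hm', ← hsp]
    have hdec : (((0 : ℝ), U t x) : ℝ × E3) =
        (U t x 0 * e 0 + U t x 1 * e 1) • (((0 : ℝ), e) : ℝ × E3) + (U t x 1 * e 0 - U t x 0 * e 1) • (((0 : ℝ), Jvec e) : ℝ × E3)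
          + U t x 2 • (((0 : ℝ), e2) : ℝ × E3) := by
      refine Prod.ext ?_ ?_
      · simp
      · simp only [Prod.snd_add, Prod.smul_snd]
        exact frame_decomp he2 hunit (U t x)
    rw [hdec, map_add, map_add, map_smul, map_smul, map_smul, smul_eq_mul, smul_eq_mul, smul_eq_mul]
  -- (c) the Laplacian: `Δg = (1 − μ)(g_mm + g_ss)`
  have h_c : Δ (fun y : E3 => fderiv ℝ (U t) y e 2) x = (1 - μ t z) * (pd dN (pd dN g) p + pd (tg eS) (pd (tg eS) g) p) := by
    have hsum := pd_sum_gST_comp_shearMap (W := W) (e := e) hO hT hW he2 hunit hOT hD hd hOD hp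
    have hμd : ∀ z' : ℝ, |z'| < ρ → DifferentiableAt ℝ (μ t) z' := fun z' _ => (hμx.differentiable (by norm_num)) z'
    have hlap := laplacian_horizDeriv_two (u := U t) hs (fun y => div_coord (hdiv t ht0) y) (m := μ t) (ρ := ρ) hμd
      (fun y hy b hb => hslabU t htρ y hy b hb) he2 (x := x) (by rw [hx2]; exact hzρ)
    rw [hx2] at hlap
    rw [hsum]
    exact hlap
  -- (d) the coupling `(DU[DU e])₂ = P·g + Q·θ_ν + g·θ_z`
  have hUd : DifferentiableAt ℝ W (t, x) := (regular_at hT hW (q := (t, x)) htT).2.1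
  have hg0 : g p = fderiv ℝ (U t) x e 2 := gST_slice (e := e) hT hW htT x
  have hinner : ∀ a b : E3, ⟪a, b⟫_ℝ = b 0 * a 0 + b 1 * a 1 + b 2 * a 2 := fun a b => by
    simp only [PiLp.inner_apply, RCLike.inner_apply, conj_trivial, Fin.sum_univ_three]
  have hJ0 : (Jvec e) 0 = -(e 1) := by simp [Jvec]
  have hJ1 : (Jvec e) 1 = e 0 := by simp [Jvec]
  have hJ2 : (Jvec e) 2 = 0 := by simp [Jvec]
  have hP0 : (PST W e ∘ shearMap e d) p = fderiv ℝ (U t) x e 0 * e 0 + fderiv ℝ (U t) x e 1 * e 1 := by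
    show PST W e (t, x) = _
    rw [PST, ← fderiv_slice_eq hUd e, hWt, hinner, he2]
    ring
  have hQ0 : (QST W e ∘ shearMap e d) p = fderiv ℝ (U t) x e 1 * e 0 - fderiv ℝ (U t) x e 0 * e 1 := by
    show QST W e (t, x) = _
    rw [QST, ← fderiv_slice_eq hUd e, hWt, hinner, hJ0, hJ1, hJ2]
    ring
  have h_d : fderiv ℝ (U t) x (fderiv ℝ (U t) x e) 2 =
      (PST W e ∘ shearMap e d) p * g p + (QST W e ∘ shearMap e d) p * fderiv ℝ (U t) x (Jvec e) 2 + g p * fderiv ℝ (U t) x e2 2 := by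
    rw [hP0, hQ0, hg0]; exact coupling_frame (U t) x he2 hunit
  -- (e) the right-hand side
  have h_e : fderiv ℝ (fun y : E3 => fderiv ℝ (U t) y e 2) x (EuclideanSpace.single 2 1) =
      pd (tg PoloidalWindowDoorLrcModEntireShearedCoordinates.eZ) g p - fderiv ℝ d (t, z) ((0 : ℝ), (1 : ℝ)) * pd dN g p := by
    rw [hz', hsp]; rfl
  /- (3) assemble -/
  rw [h_a, h_b, h_c, h_d, h_e, ← hg0] at hlaw
  linear_combination hlaw

/-- ★★ **THE SAME ROW IN THE LEAD's TEMPLATE SHAPE `hR3`** (`…SheetSystemMixed.eq_zero_of_mixedSystem_template`, `wS = eS`, `wT = eT`, `wZ = eZ`, `α₁ = −1`):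
solved for `∂_m²g` when `μ(t,z) ≠ 1` (on the characteristic slab `μ ≤ 0`).  The coefficients are explicit functions of the tube point (smooth wherever the
class profile, `μ` and `d` are): with `ν := 1 − μ(t,z)`, `c := μ_t + θμ_z − μ_zz`,
`∂_m²g = −∂_s²g + (1/ν)·∂_t′g + ((νθ + 2μ_z)/ν²)·∂_z′g + (U_e/ν)·∂_sg + ((ν(U_ν − d_t − θd_z) − 2μ_zd_z)/ν²)·∂_mg + ((νθ_z − c)/ν²)·g + (g/ν)·P + (θ_ν/ν)·Q`. -/
theorem verticalRow_template
    (hrate : FluidPDE.HasTypeITimeDecay C U) (hcont : ContinuousOn (uncurry U) (Iio (0 : ℝ) ×ˢ univ))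
    (hmild : ∀ s t : ℝ, s < t → t < 0 → ∀ x, U t x = UnboundedOperators.heatExtension (U s) (t - s) x - FluidPDE.oseenDuhamel 1 s U U t x)
    (hdiv : ∀ t < 0, FluidPDE.VectorCalculus.IsDivFree (U t))
    (hpol : ∀ s < 0, ∀ y, ⟪FluidPDE.curl (U s) y, EuclideanSpace.single 2 1⟫_ℝ = 0)
    (hμ3 : ContDiff ℝ 3 (uncurry μ))
    (hslabU : ∀ t : ℝ, |t + 1| < ρ → ∀ x : E3, |x 2| < ρ → ∀ b : Fin 3, b ≠ 2 →
      fderiv ℝ (U t) x (EuclideanSpace.single 2 1) b = μ t (x 2) * fderiv ℝ (U t) x (EuclideanSpace.single b 1) 2)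
    (he2 : e 2 = 0) (hunit : e 0 ^ 2 + e 1 ^ 2 = 1)
    (hO : IsOpen O) (hOt : ∀ y ∈ O, y.1 < 0 ∧ |y.1 + 1| < ρ ∧ |y.2.2| < ρ) (hμ1 : ∀ y ∈ O, μ y.1 y.2.2 ≠ 1)
    (hD : IsOpen D) (hd : ContDiffOn ℝ ∞ d D) (hOD : ∀ y ∈ O, (y.1, y.2.2) ∈ D) {p : Y3 × ℝ} (hp : p ∈ tube O) :
    pd dN (pd dN (gST (uncurry U) e ∘ shearMap e d)) p =
      (-1 : ℝ) * pd (tg eS) (pd (tg eS) (gST (uncurry U) e ∘ shearMap e d)) p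
        + (1 / (1 - μ p.1.1 p.1.2.2)) * pd (tg eT) (gST (uncurry U) e ∘ shearMap e d) p
        + (((1 - μ p.1.1 p.1.2.2) * U p.1.1 (shearPt e d p) 2 + 2 * deriv (μ p.1.1) p.1.2.2) / (1 - μ p.1.1 p.1.2.2) ^ 2) *
            pd (tg PoloidalWindowDoorLrcModEntireShearedCoordinates.eZ) (gST (uncurry U) e ∘ shearMap e d) p
        + ((U p.1.1 (shearPt e d p) 0 * e 0 + U p.1.1 (shearPt e d p) 1 * e 1) / (1 - μ p.1.1 p.1.2.2)) *
            pd (tg eS) (gST (uncurry U) e ∘ shearMap e d) p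
        + (((1 - μ p.1.1 p.1.2.2) * ((U p.1.1 (shearPt e d p) 1 * e 0 - U p.1.1 (shearPt e d p) 0 * e 1)
              - fderiv ℝ d (p.1.1, p.1.2.2) ((1 : ℝ), (0 : ℝ)) - U p.1.1 (shearPt e d p) 2 * fderiv ℝ d (p.1.1, p.1.2.2) ((0 : ℝ), (1 : ℝ)))
              - 2 * deriv (μ p.1.1) p.1.2.2 * fderiv ℝ d (p.1.1, p.1.2.2) ((0 : ℝ), (1 : ℝ))) / (1 - μ p.1.1 p.1.2.2) ^ 2) *
            pd dN (gST (uncurry U) e ∘ shearMap e d) p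
        + (((1 - μ p.1.1 p.1.2.2) * fderiv ℝ (U p.1.1) (shearPt e d p) e2 2
              - (deriv (fun s => μ s p.1.2.2) p.1.1 + U p.1.1 (shearPt e d p) 2 * deriv (μ p.1.1) p.1.2.2 - deriv (deriv (μ p.1.1)) p.1.2.2))
              / (1 - μ p.1.1 p.1.2.2) ^ 2) * (gST (uncurry U) e ∘ shearMap e d) p
        + ((gST (uncurry U) e ∘ shearMap e d) p / (1 - μ p.1.1 p.1.2.2)) * (PST (uncurry U) e ∘ shearMap e d) p
        + (fderiv ℝ (U p.1.1) (shearPt e d p) (Jvec e) 2 / (1 - μ p.1.1 p.1.2.2)) * (QST (uncurry U) e ∘ shearMap e d) p := by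
  have h := verticalRow_sheared hrate hcont hmild hdiv hpol hμ3 hslabU he2 hunit hO hOt hD hd hOD hp
  have hν : (1 - μ p.1.1 p.1.2.2) ≠ 0 := sub_ne_zero.2 (Ne.symm (hμ1 p.1 hp))
  field_simp
  linear_combination (-1 : ℝ) * h

end Summit.NavierStokesRegularity.NavierStokesRegularity.Theorems.PoloidalWindowDoorLrcModEntireShearedVerticalRow
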